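import Mathlib
import Summits.BirchSwinnertonDyer.BirchSwinnertonDyer.Theorems.ResidualThetaTransportAtTwoSignedMuSeedAtTwoPlusNonsquareDescentTorsionExponent
import HarnessLib

/-!
# Non-square descent — IWASAWA GROWTH AT `μ = 0`, PART III: THE HYPOTHESES OF THE GROWTH LEMMA FROM THE S3 (c) CERTIFICATE («`Q'/2Q'` torsion»),
# NOETHERIANITY AND LOCALITY — seed crux `SignedMuSeedAtTwoPlus` stmt-BirchSwinnertonDyer-21438 (parent Kμ⁺ `SignedMuVanishingAtTwoPlus`
# stmt-BirchSwinnertonDyer-20689, route ResidualThetaTransportAtTwo), line card `Cruxes/SignedMuSeedAtTwoPlus/Lines/nonsquare-descent.md`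

Cell `bsd-wall`, width seat `bsd-wall-rtt-p4-w2` g18 (`--supports`, closes nothing).  THEOREMS ONLY; BSD is not proved by this and
nothing arithmetic is asserted: module algebra.

The linear-growth theorem `natCard_quotient_omega_eq_mul_pow` (`Theorems/…NonsquareDescentGrowthLinear.lean`) takes: (`hjac`) `(p) ⊆ Jac(R)`,
(`hT`) `T^{N₀} M ⊆ pM` («`μ = 0`»), (`htor`) bounded `p`-power torsion, `M` finitely generated.  For the card's `M = Q' = Ē^χ/Λ'u_∞` over
`Λ' = 𝒪⟦X⟧`: `hjac` is locality of `Λ'` (§1); `htor` is Noetherianity (§2); and `hT` is EXACTLY what the S3 (c) certificate delivers — «`Q'/2Q' =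
V_∞/⟨ū_∞⟩` is torsion» (g17's `isTorsion_quotient_iff_exists_proj_ne_zero`, this lane's `…_of_lattice`) — read back on `Q'` (§3–§4): a finitely
generated torsion `k⟦X⟧`-module (`k` finite) is finite, hence killed by a power `X^{N₀}` (`…TorsionExponent`), i.e. `T^{N₀} Q' ⊆ p Q'` along any
quotient map `q : Q' ↠ Q'/pQ'` compatible with `𝒪⟦X⟧ → k⟦X⟧`, `T ↦ X`.  So «`∃ m GNS(m)` ⟹ `μ(Q') = 0` ⟹ linear growth of `#(Q'/ω_nQ')`» is now
ONE kernel chain (modulo the arithmetic identifications listed in `Cruxes/SignedMuVanishingAtTwoPlus/RankOneKernel.md` §2).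

* §1 `span_le_jacobson_bot_of_not_isUnit` — in a local ring, `(c) ⊆ Jac` for every non-unit `c` (e.g. `c = p ∈ Λ'`).
* §2 **`exists_uniform_pow_torsion_of_isNoetherian`** — bounded `c`-power torsion for Noetherian modules (the chain `M[cⁱ]` stabilises).
* §3 `exists_smul_top_eq_bot_of_torsion` — f.g. + every element torsion (over a domain) ⇒ ONE `c ≠ 0` kills the module;
  `exists_X_pow_smul_eq_zero_of_torsion` — over `k⟦X⟧`, `k` finite: such a module is killed by some `X^{N₀}`.
* §4 **`T_pow_smul_top_le_of_quotient_torsion`** — transport to `M`: if `q : M → W` is `R`-linear with kernel inside `pM`, `W` carries a compatible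
  `S`-structure along `φ : R → S` with `φ T = X`, and `X^{N₀}` kills `W`, then `span{T^{N₀}} • ⊤ ≤ span{p} • ⊤` in `M` — the input `hT`.

[folklore]
-/

set_option autoImplicit false
-- the Theorems namespace of this sub repeats the summit name by design (D-0017 nested layout)
set_option linter.dupNamespace false

open scoped Pointwise

namespace Summit.BirchSwinnertonDyer.BirchSwinnertonDyer.Theorems.SignedMuAtTwo.NonsquareDescent

/-! ## §1 `(c) ⊆ Jac(R)` in a local ring -/

section Local

variable {R : Type*} [CommRing R]

/-- In a local ring every non-unit generates an ideal inside the Jacobson radical (`= 𝔪`): the hypothesis `hjac` of the growth lemma for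
`c = p ∈ Λ' = 𝒪⟦X⟧`. [folklore] -/
theorem span_le_jacobson_bot_of_not_isUnit [IsLocalRing R] {c : R} (hc : ¬ IsUnit c) :
    Ideal.span {c} ≤ (⊥ : Ideal R).jacobson := by
  rw [IsLocalRing.jacobson_eq_maximalIdeal ⊥ bot_ne_top, Ideal.span_singleton_le_iff_mem]
  exact (IsLocalRing.mem_maximalIdeal c).mpr hc

/-- For power series: `C a` is a non-unit of `A⟦X⟧` when `a` is a non-unit of `A` (constant coefficient), so `(C a) ⊆ Jac(A⟦X⟧)` for `A⟦X⟧`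
local; in particular for `a = p`, `(p : A⟦X⟧) = C (p : A)`. [folklore] -/
theorem natCast_span_le_jacobson_bot_powerSeries {A : Type*} [CommRing A] [IsLocalRing A] (p : ℕ)
    (hp : ¬ IsUnit (p : A)) :
    Ideal.span {(p : PowerSeries A)} ≤ (⊥ : Ideal (PowerSeries A)).jacobson := by
  refine span_le_jacobson_bot_of_not_isUnit fun h => hp ?_
  rw [PowerSeries.isUnit_iff_constantCoeff, map_natCast] at h
  exact h

end Local

/-! ## §2 Bounded `c`-power torsion from Noetherianity -/

section Torsion

variable {R : Type*} [CommRing R] {M : Type*} [AddCommGroup M] [Module R M]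

/-- **Noetherian ⇒ bounded `c`-power torsion**: there is `k` with `cⁱ x = 0 ⟹ cᵏ x = 0` for all `x`, `i` (the chain of submodules `M[cⁱ]`
stabilises) — the hypothesis `htor` of the growth lemma. [folklore] -/
theorem exists_uniform_pow_torsion_of_isNoetherian [IsNoetherian R M] (c : R) :
    ∃ k : ℕ, ∀ (x : M) (i : ℕ), c ^ i • x = 0 → c ^ k • x = 0 := by
  let f : ℕ →o Submodule R M :=
    ⟨fun i => Submodule.torsionBy R M (c ^ i), fun i j hij x hx => by
      rw [Submodule.mem_torsionBy_iff] at hx ⊢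
      obtain ⟨d, rfl⟩ := Nat.exists_eq_add_of_le hij
      rw [pow_add, mul_comm, mul_smul, hx, smul_zero]⟩
  obtain ⟨k, hk⟩ := monotone_stabilizes_iff_noetherian.mpr (inferInstance : IsNoetherian R M) f
  refine ⟨k, fun x i hx => ?_⟩
  have hmono : ∀ i j, i ≤ j → ∀ y : M, c ^ i • y = 0 → c ^ j • y = 0 := fun i j hij y hy => by
    obtain ⟨d, rfl⟩ := Nat.exists_eq_add_of_le hij
    rw [pow_add, mul_comm, mul_smul, hy, smul_zero]
  rcases le_or_gt i k with hik | hki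
  · exact hmono i k hik x hx
  · have h1 : x ∈ f i := (Submodule.mem_torsionBy_iff _ _).mpr hx
    rw [← hk i hki.le] at h1
    exact (Submodule.mem_torsionBy_iff _ _).mp h1

end Torsion

/-! ## §3 A finitely generated torsion module over a domain has a uniform annihilator; over `k⟦X⟧` it is killed by `X^{N₀}` -/

section Uniform

variable {S : Type*} [CommRing S] [IsDomain S] {W : Type*} [AddCommGroup W] [Module S W]

/-- **f.g. + every element torsion ⇒ one `c ≠ 0` kills everything** (product of the annihilators of a finite generating set). [folklore] -/
theorem exists_ne_zero_forall_smul_eq_zero_of_torsion [Module.Finite S W]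
    (htor : ∀ w : W, ∃ b : S, b ≠ 0 ∧ b • w = 0) : ∃ c : S, c ≠ 0 ∧ ∀ w : W, c • w = 0 := by
  classical
  obtain ⟨s, hs⟩ := Module.Finite.fg_top (R := S) (M := W)
  choose b hb0 hb using htor
  refine ⟨∏ g ∈ s, b g, Finset.prod_ne_zero_iff.mpr fun g _ => hb0 g, fun w => ?_⟩
  have hw : w ∈ Submodule.span S (s : Set W) := by rw [hs]; exact Submodule.mem_top
  induction hw using Submodule.span_induction with
  | mem g hg =>
    rw [← Finset.prod_erase_mul s b (Finset.mem_coe.mp hg), mul_smul, hb, smul_zero]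
  | zero => rw [smul_zero]
  | add x y _ _ hx hy => rw [smul_add, hx, hy, add_zero]
  | smul r x _ hx => rw [smul_comm, hx, smul_zero]

end Uniform

section PowerSeriesTorsion

/-- **Over `k⟦X⟧` with `k` finite: a finitely generated module in which every element is torsion is killed by some `X^{N₀}`** (it is finite —
`finite_of_fg_of_smul_eq_zero`-style via a uniform annihilator `c = X^a·unit` — and `X ∈ 𝔪` acts nilpotently on a finite module,
`exists_pow_smul_eq_zero_of_mem_maximalIdeal`).  For the card: `W = Q'/2Q' = V_∞/⟨ū_∞⟩`, torsion by the S3 (c) certificate. [folklore] -/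
theorem exists_X_pow_smul_eq_zero_of_torsion {k : Type*} [Field k] [Finite k] {W : Type*} [AddCommGroup W]
    [Module (PowerSeries k) W] [Module.Finite (PowerSeries k) W]
    (htor : ∀ w : W, ∃ b : PowerSeries k, b ≠ 0 ∧ b • w = 0) :
    ∃ N₀ : ℕ, ∀ w : W, (PowerSeries.X : PowerSeries k) ^ N₀ • w = 0 := by
  obtain ⟨c, hc, hcW⟩ := exists_ne_zero_forall_smul_eq_zero_of_torsion htor
  -- `c = X^a · unit`, so `X^a` kills `W`
  refine ⟨c.order.toNat, fun w => ?_⟩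
  obtain ⟨u, hu⟩ := PowerSeries.isUnit_divided_by_X_pow_order hc
  have hcu : (PowerSeries.X : PowerSeries k) ^ c.order.toNat * (u : PowerSeries k) = c := by
    rw [hu]; exact PowerSeries.X_pow_order_mul_divXPowOrder
  generalize c.order.toNat = a at hcu ⊢
  have h : c • ((↑u⁻¹ : PowerSeries k) • w) = (PowerSeries.X : PowerSeries k) ^ a • w := by
    rw [← hcu, mul_smul, ← mul_smul (u : PowerSeries k), Units.mul_inv, one_smul]
  rw [← h]
  exact hcW _

end PowerSeriesTorsion

/-! ## §4 Transport: `X^{N₀}` kills `M/pM` ⟹ `T^{N₀} M ⊆ pM` -/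

section Transport

variable {R : Type*} [CommRing R] {M : Type*} [AddCommGroup M] [Module R M]
  {S : Type*} [CommRing S] {W : Type*} [AddCommGroup W] [Module R W] [Module S W]

/-- **The input `hT` of the growth lemma from the S3 (c) certificate.**  `q : M → W` `R`-linear with `q m = 0 → m ∈ pM` (e.g. `W = M/pM`), an
`S`-module structure on `W` compatible with `φ : R →+* S` (`r • w = φ r • w`), `φ T = X`, and `X^{N₀}` killing `W`: then
`span{T^{N₀}} • ⊤ ≤ span{p} • ⊤` in `M`.  (For the card: `R = Λ'`, `S = 𝔽₄⟦X⟧`, `T = X ∈ Λ'`, `p = 2`, `W = Q'/2Q'`.) [folklore] -/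
theorem T_pow_smul_top_le_of_quotient_torsion (φ : R →+* S) (hcompat : ∀ (r : R) (w : W), r • w = φ r • w)
    (q : M →ₗ[R] W) {c : R} (hker : ∀ m : M, q m = 0 → ∃ y : M, m = c • y)
    {T : R} {X : S} (hTX : φ T = X) {N₀ : ℕ} (hX : ∀ w : W, X ^ N₀ • w = 0) :
    Ideal.span {T ^ N₀} • (⊤ : Submodule R M) ≤ Ideal.span {c} • ⊤ := by
  rw [Submodule.smul_le]
  intro r hr m _
  obtain ⟨a, rfl⟩ := Ideal.mem_span_singleton'.mp hr
  rw [mul_smul]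
  refine Submodule.smul_mem _ a ?_
  have h0 : q (T ^ N₀ • m) = 0 := by
    rw [map_smul, hcompat, map_pow, hTX, hX]
  obtain ⟨y, hy⟩ := hker _ h0
  rw [hy]
  exact Submodule.smul_mem_smul (Ideal.mem_span_singleton_self c) Submodule.mem_top

/-- The same for the actual quotient map `M → M ⧸ cM`. [folklore] -/
theorem T_pow_smul_top_le_of_mkQ_torsion (φ : R →+* S) {c : R}
    [Module S (M ⧸ (c • (⊤ : Submodule R M)))]
    (hcompat : ∀ (r : R) (w : M ⧸ (c • (⊤ : Submodule R M))), r • w = φ r • w)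
    {T : R} {X : S} (hTX : φ T = X) {N₀ : ℕ} (hX : ∀ w : M ⧸ (c • (⊤ : Submodule R M)), X ^ N₀ • w = 0) :
    Ideal.span {T ^ N₀} • (⊤ : Submodule R M) ≤ Ideal.span {c} • ⊤ := by
  refine T_pow_smul_top_le_of_quotient_torsion φ hcompat (c • (⊤ : Submodule R M)).mkQ (fun m hm => ?_) hTX hX
  rw [Submodule.mkQ_apply, Submodule.Quotient.mk_eq_zero, Submodule.mem_smul_pointwise_iff_exists] at hm
  obtain ⟨y, -, hy⟩ := hm
  exact ⟨y, hy.symm⟩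

end Transport

end Summit.BirchSwinnertonDyer.BirchSwinnertonDyer.Theorems.SignedMuAtTwo.NonsquareDescent
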